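import Summits.ResolutionOfSingularities.ResolutionOfSingularities.Theorems.PurelyInseparableDim4ResConeHeavyLoseStep
import Summits.ResolutionOfSingularities.ResolutionOfSingularities.Theorems.PurelyInseparableDim4PhiLineIsolationLetters
import Summits.ResolutionOfSingularities.ResolutionOfSingularities.Theorems.PurelyInseparableDim4ResConeHeavyEntryFrame
import HarnessLib
import HarnessLib.Audit.Tags

/-!
# Purely inseparable four-folds — the HEAVY LOSE STEP WITH A FROZEN CONE SET («L_set»), every prime `p`, every tame shade `d < p`
# (rung-2 frame «Φ-line with a frozen cone monomial» of the K2(p) lane; the LOSE third; cell `res-dim4-pi`)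

[OURS · counted 0 · cell `res-dim4-pi` · K2(p) lane holder res-dim4-p-12 g5, HOLDER RULINGS g5-4 (5) 2026-08-29 09:57Z «FROZEN CONE LETTERS
COUNT TOWARD CRITICALITY» (res-dim4-p-11 g5's observation l.5770): owners E_set = res-dim4-p-9, K_set = res-dim4-p-7, **L_set = res-dim4-p-2**,
α/labels = res-dim4-p-11, tracker_set = holder; seat res-dim4-p-2 g6 over its lineage's L_gen `heavy_lose_step` (p709039).]  Nothing here
proves any TAIL(p, d, e), K2(7), K2(p) or resolution of singularities in dimension ≥ 4 / characteristic `p` — NOT proved.  AI kernel work,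
weaker than expert review.

WHAT CHANGES relative to L_gen `heavy_lose_step`: its exponent `n` is SPLIT into `e := p − w′` (the newborn's residual exponent:
`p ∤ w′`, `R ∈ (x_{j k})^e`, threshold of XV §4 / R3b-n, XVI) and a SET exponent `m ≤ e`, `1 ≤ m ≤ d`, of `T′ := insert (j k) P` for a
finite set `P` of CONE LETTERS OF THE PARENT (`∀ v ∈ resVertex (c k), v_z = 0`) with `p ≤ Σ_{i ∈ T′} r_{k+1} i + m`; the child's
α-clause is res-dim4-p-11 g5's `PhiLine.mul_alphaS_le_of_isIsolated_letters` (p711809) and reads `d·αs′ ≤ (m − 1)·d!` — a LIGHT newborn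
(`w′ < p − d`) beside a frozen cone monomial of weight `W` is admissible as soon as `w′ + W ≥ p − d`.  Cone-ness is used AT THE PARENT
ONLY: §1 `inverse_col_mem_of_rows_annihilate` / `inverse_apply_eq_zero_of_cone` (the `u`-columns of a left inverse lie in the plane the
y-rows annihilate ⇒ `M z u₁ = M z u₂ = 0` for a cone letter `z`), kept by the twist; §2 `linearForm_update_zero` / `arrival_X_mem_yu1Ideal`
(`y^S_i = y′_i + S_i(j k)·u₁′` ⇒ `x_z ∈ (y′₁, y′₂, u₁′)` in every ARRIVAL frame = p711809's `hT`); the re-adapted frame inherits `αs` (XVI).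
§3 **`heavy_lose_step_letters`**: binders of L_gen with `(hn1 hnd hnp hr')` replaced by `{e m} (he1) (hep) (hm1) (hmd) (hme)` and
`(P) (hPcone) (hcritT)`; conclusion = L_gen's RUN frame at `k+1` on `j k` with `d·αs′ ≤ (m − 1)·d!`, `0 < αs′`, `βs′ ≤ βs`.
`heavy_lose_step` is the instance `P = ∅`, `m = e = n`.
[cite: CossartJannsenSaito2020, Lemma 11.5, Lemma 12.1 (3), Lemma 12.2 (1), Lemma 13.6] [cite: CossartPiltant2008, Lemma 4.5 (2)] [cite: Hauser2010, §§F–G]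
bears_on: LADDER-RESOLUTION:D157-DOOR2 (res-dim4-pi · K2(p) · rung-2 frame «Φ-line with a frozen cone monomial» · L_set).
Supports stmt-ResolutionOfSingularities-16155 (helper).
-/

set_option linter.dupNamespace false -- mandated namespace of this single-conjunct summit

noncomputable section

namespace Summit.ResolutionOfSingularities.ResolutionOfSingularities.Theorems.PIDim4

namespace ResCone

open MvPolynomial Finset IsLocalRing
open Literature.AlgebraicGeometry.Resolution
open Literature.AlgebraicGeometry.Resolution.CentreBlowup
open Literature.AlgebraicGeometry.Resolution.Hauser2010
open Literature.AlgebraicGeometry.Resolution.HauserPerlega2019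
open Literature.AlgebraicGeometry.Resolution.WeightedOrder
open PointBlowup (direction additiveSubspace)

variable {K : Type} [Field K]

section Frame

variable [DecidableEq K]

/-- **The `u`-columns of a left inverse lie in the annihilated plane**: `M·L = 1`, the y-rows of `L` annihilate `V ≤ K⁴` of rank `2` ⇒
the `u₁`/`u₂`-columns of `M` lie in `V` (every `v` is `Σ_u ⟨L_u, v⟩·Mcol_u`). [OURS · linear algebra] [cite: CossartJannsenSaito2020, Def. 8.2] -/
theorem inverse_col_mem_of_rows_annihilate {V : Submodule K (Fin 4 → K)} (hV : Module.finrank K V = 2)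
    {L : Fin (2 + 2) → Fin 4 → K} {M : Fin 4 → Fin (2 + 2) → K} (hM : ∀ t u, ∑ i, M t i * L i u = if t = u then 1 else 0)
    (hy : ∀ i, i ≠ u1 2 → i ≠ u2 2 → ∀ w ∈ V, ∑ t, L i t * w t = 0) {u : Fin (2 + 2)} (hu : u = u1 2 ∨ u = u2 2) :
    (fun t => M t u) ∈ V := by
  classical
  set c1 : Fin 4 → K := fun t => M t (u1 2) with hc1
  set c2 : Fin 4 → K := fun t => M t (u2 2) with hc2
  set U : Submodule K (Fin 4 → K) := Submodule.span K (({c1, c2} : Finset (Fin 4 → K)) : Set (Fin 4 → K)) with hU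
  obtain ⟨h0u1, h0u2, h1u1, h1u2, -, -⟩ := frameIndex_ne
  -- every vector is `Σ_u ⟨L_u, v⟩ · Mcol_u`
  have hdec : ∀ w : Fin 4 → K, ∀ s, w s = ∑ i, M s i * ∑ t, L i t * w t := by
    intro w s
    have h1 : ∑ i, M s i * ∑ t, L i t * w t = ∑ t, (∑ i, M s i * L i t) * w t := by
      simp_rw [Finset.mul_sum, ← mul_assoc]
      rw [Finset.sum_comm]
      simp_rw [← Finset.sum_mul]
    rw [h1]
    simp_rw [hM]
    simp only [ite_mul, one_mul, zero_mul, Finset.sum_ite_eq, Finset.mem_univ, if_true]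
  have hVU : V ≤ U := by
    intro w hw
    have hw' : w = (∑ t, L (u1 2) t * w t) • c1 + (∑ t, L (u2 2) t * w t) • c2 := by
      funext s
      rw [hdec w s, sum_frameIndex, hy 0 h0u1 h0u2 w hw, hy 1 h1u1 h1u2 w hw, mul_zero, mul_zero, zero_add, zero_add]
      simp only [hc1, hc2, Pi.add_apply, Pi.smul_apply, smul_eq_mul]
      ring
    rw [hw']
    refine U.add_mem (U.smul_mem _ (Submodule.subset_span ?_)) (U.smul_mem _ (Submodule.subset_span ?_))
    · simp
    · simp
  have hUle : Module.finrank K U ≤ Module.finrank K V := by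
    rw [hV]
    exact (finrank_span_finset_le_card _).trans Finset.card_le_two
  have hVeq : V = U := Submodule.eq_of_le_of_finrank_le hVU hUle
  have hmem : (fun t => M t u) ∈ U := by
    refine Submodule.subset_span ?_
    rcases hu with rfl | rfl
    · simp [hc1]
    · simp [hc2]
  rw [hVeq]
  exact hmem

/-- **A cone letter has no `u`-coordinates**: with `M·L = 1`, y-rows ⟂ `V` of rank `2`, and `v z = 0` for all `v ∈ V`,
`M z u₁ = M z u₂ = 0`. [OURS · linear algebra] [cite: CossartJannsenSaito2020, Def. 8.2] -/
theorem inverse_apply_eq_zero_of_cone {V : Submodule K (Fin 4 → K)} (hV : Module.finrank K V = 2)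
    {L : Fin (2 + 2) → Fin 4 → K} {M : Fin 4 → Fin (2 + 2) → K} (hM : ∀ t u, ∑ i, M t i * L i u = if t = u then 1 else 0)
    (hy : ∀ i, i ≠ u1 2 → i ≠ u2 2 → ∀ w ∈ V, ∑ t, L i t * w t = 0) {z : Fin 4} (hz : ∀ v ∈ V, v z = 0) :
    M z (u1 2) = 0 ∧ M z (u2 2) = 0 :=
  ⟨hz _ (inverse_col_mem_of_rows_annihilate hV hM hy (Or.inl rfl)),
    hz _ (inverse_col_mem_of_rows_annihilate hV hM hy (Or.inr rfl))⟩

end Frame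

section Arrival

/-- Dropping one coefficient of a linear form: `Σ_t C (f.update j₀ 0)_t x_t = Σ_t C f_t x_t − C f_{j₀} x_{j₀}`. [folklore] -/
theorem linearForm_update_zero [DecidableEq K] (f : Fin 4 → K) (j₀ : Fin 4) :
    (∑ t, C (Function.update f j₀ 0 t) * X t : MvPolynomial (Fin 4) K) = ∑ t, C (f t) * X t - C (f j₀) * X j₀ := by
  rw [eq_sub_iff_add_eq, ← Finset.add_sum_erase _ _ (Finset.mem_univ j₀),
    ← Finset.add_sum_erase _ (fun t => C (f t) * X t) (Finset.mem_univ j₀), Function.update_self, C_0, zero_mul, zero_add]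
  rw [add_comm]
  congr 1
  exact Finset.sum_congr rfl fun t ht => by rw [Function.update_of_ne (Finset.ne_of_mem_erase ht)]

/-- **A parent cone letter lies in `(y′₁, y′₂, u₁′)` of every arrival frame**: if `MS·S = 1`, `MS z u₁ = MS z u₂ = 0`, and `L′` is an
ARRIVAL frame off `S` (`L′ u₁ = e_m`, `L′ i = (S i).update m 0` for `i ≠ u₁`), then `x_z = Σ_{k<2} MS z y_k·y′_k + (Σ_{k<2} MS z y_k·S_{y_k} m)·u₁′`
lies in `yu1Ideal` of the frame of `L′` — the `hT` of `mul_alphaS_le_of_isIsolated_letters`. [OURS · linear algebra]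
[cite: CossartJannsenSaito2020, Def. 8.2, Lemma 11.5] -/
theorem arrival_X_mem_yu1Ideal [DecidableEq K] {S L' : Fin (2 + 2) → Fin 4 → K} {MS : Fin 4 → Fin (2 + 2) → K}
    (hMS : ∀ t u, ∑ i, MS t i * S i u = if t = u then 1 else 0) {m z : Fin 4}
    (hL'u1 : L' (u1 2) = Pi.single m 1) (hL' : ∀ i, i ≠ u1 2 → L' i = Function.update (S i) m 0)
    (hz1 : MS z (u1 2) = 0) (hz2 : MS z (u2 2) = 0) :
    algebraMap (MvPolynomial (Fin 4) K) (OriginLocalization K 4) (X z) ∈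
      yu1Ideal (fun i => algebraMap (MvPolynomial (Fin 4) K) (OriginLocalization K 4) (∑ t, C (L' i t) * X t)) := by
  classical
  obtain ⟨h0u1, -, h1u1, -, -, -⟩ := frameIndex_ne
  -- the polynomial identity
  have hℓ : ∀ i, i ≠ u1 2 → (∑ t, C (S i t) * X t : MvPolynomial (Fin 4) K) =
      (∑ t, C (L' i t) * X t) + C (S i m) * ∑ t, C (L' (u1 2) t) * X t := by
    intro i hi
    rw [hL' i hi, linearForm_update_zero, hL'u1, PhiLine.sum_C_single_mul_X]
    ring
  have hX : (X z : MvPolynomial (Fin 4) K) =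
      ∑ k : Fin 2, C (MS z (Fin.castAdd 2 k)) * (∑ t, C (L' (Fin.castAdd 2 k) t) * X t) +
        C (∑ k : Fin 2, MS z (Fin.castAdd 2 k) * S (Fin.castAdd 2 k) m) * ∑ t, C (L' (u1 2) t) * X t := by
    rw [X_eq_sum_C_mul_linearForm hMS z, sum_frameIndex, hz1, hz2, C_0, zero_mul, zero_mul, add_zero, add_zero,
      hℓ 0 h0u1, hℓ 1 h1u1, Fin.sum_univ_two, Fin.sum_univ_two]
    show C (MS z 0) * (∑ t, C (L' 0 t) * X t + C (S 0 m) * ∑ t, C (L' (u1 2) t) * X t) +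
        C (MS z 1) * (∑ t, C (L' 1 t) * X t + C (S 1 m) * ∑ t, C (L' (u1 2) t) * X t) =
      C (MS z 0) * (∑ t, C (L' 0 t) * X t) + C (MS z 1) * (∑ t, C (L' 1 t) * X t) +
        C (MS z 0 * S 0 m + MS z 1 * S 1 m) * ∑ t, C (L' (u1 2) t) * X t
    rw [C_add, C_mul, C_mul]
    ring
  refine PhiLine.algebraMap_X_mem_yu1Ideal_of_eq_sum (fun k => MS z (Fin.castAdd 2 k))
    (∑ k : Fin 2, MS z (Fin.castAdd 2 k) * S (Fin.castAdd 2 k) m) ?_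
  rw [hX, map_add, map_sum, map_mul]
  simp only [map_mul]

end Arrival

section Lose

variable [DecidableEq K]

/-- **THE HEAVY LOSE STEP WITH A FROZEN CONE SET, p-GENERIC** («L_set»): `heavy_lose_step` with the exponent split — `e` the newborn's
residual exponent (`|r_k| + d − p + e = p`, `1 ≤ e`), `m` the SET exponent (`1 ≤ m ≤ d`, `m ≤ e`) of `insert (j k) P`, `P` a finite set of
CONE LETTERS OF THE PARENT, `p ≤ Σ_{i ∈ insert (j k) P} r_{k+1} i + m`; same factorisation package, hit pattern and ENTRY frame as L_gen;
conclusion: a RUN frame at `k+1` on `j k` with **`d·αs′ ≤ (m − 1)·d!`**, `0 < αs′`, `βs′ ≤ βs`.  Proof = L_gen's token for token, the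
three child α-clauses by `PhiLine.mul_alphaS_le_of_isIsolated_letters` (p711809) fed by §1–§2. [OURS]
[cite: CossartJannsenSaito2020, Lemma 11.5, Lemma 12.1 (3), Lemma 12.2 (1), Lemma 13.6] [cite: CossartPiltant2008, Lemma 4.5 (2)] -/
theorem heavy_lose_step_letters {p d e m : ℕ} [CharP K p] {c : ℕ → State K} {j : ℕ → Fin 4} {b : ℕ → Fin 4 → K} {k : ℕ}
    {h : Fin 4} {G G₁ : MvPolynomial (Fin 4) K}
    -- numerology
    (hdp : d < p) (he1 : 1 ≤ e) (hep : (c k).r.degree + d - p + e = p) (hm1 : 1 ≤ m) (hmd : m ≤ d) (hme : m ≤ e)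
    (hpo : p < (c k).r.degree + d) (ho2 : (c k).r.degree + d < 2 * p) (hndvd : ¬ p ∣ ((c k).r.degree + d - p))
    -- the factorisation package at `k` and `k + 1` and of the step
    (hF : (c k).F = monomial (c k).r 1 * G) (hd : ordZero G = d) (hdiv : ∀ e' ∈ (c k).F.support, (c k).r ≤ e')
    (hbj : b k (j k) = 0)
    (hF' : (CentreBlowup.step p Finset.univ (j k) (b k) (c k)).F =
      monomial ((((c k).r.filter fun i => b k i = 0)).update (j k) ((c k).r.degree + d - p)) 1 * G₁)
    (hF₁ : (c (k + 1)).F = monomial (c (k + 1)).r 1 * G₁) (hd₁ : ordZero G₁ = d) (hiso₁ : IsIsolated p (c (k + 1)).F)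
    (hshade : (CentreBlowup.step p Finset.univ (j k) (b k) (c k)).shade = (c k).shade)
    (he : Module.finrank K (resVertex (c k)) = 2) (he₁ : Module.finrank K (resVertex (c (k + 1))) = 2)
    -- the weights pattern: the step hits the letter `h` (the newborn's weight enters only through `hcritT`)
    (hhit : j k = h ∨ b k h ≠ 0)
    -- the frozen cone set at the parent and the set numerology at the child
    (P : Finset (Fin 4)) (hPcone : ∀ z ∈ P, ∀ v ∈ resVertex (c k), v z = 0)
    (hcritT : p ≤ (∑ i ∈ insert (j k) P, (c (k + 1)).r i) + m)
    -- the ENTRY frame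
    {L : Fin (2 + 2) → Fin 4 → K} {M : Fin 4 → Fin (2 + 2) → K} (hM : ∀ t u, ∑ i, M t i * L i u = if t = u then 1 else 0)
    (hLu1 : L (u1 2) = Pi.single h 1)
    (hy : ∀ i, i ≠ u1 2 → i ≠ u2 2 → ∀ w ∈ resVertex (c k), ∑ t, L i t * w t = 0)
    (hne : (pts (fun i => algebraMap (MvPolynomial (Fin 4) K) (OriginLocalization K 4) (∑ t, C (L i t) * X t))
      (Ideal.span {algebraMap (MvPolynomial (Fin 4) K) (OriginLocalization K 4) G}) d).Nonempty)
    (hδ : Nat.factorial d < deltaS (fun i => algebraMap (MvPolynomial (Fin 4) K) (OriginLocalization K 4) (∑ t, C (L i t) * X t))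
      (Ideal.span {algebraMap (MvPolynomial (Fin 4) K) (OriginLocalization K 4) G}) d) :
    ∃ (L' : Fin (2 + 2) → Fin 4 → K) (M' : Fin 4 → Fin (2 + 2) → K),
      ((∀ t u, ∑ i, M' t i * L' i u = if t = u then 1 else 0) ∧ L' (u1 2) = Pi.single (j k) 1 ∧
        (∀ i, i ≠ u1 2 → i ≠ u2 2 → ∀ w ∈ resVertex (c (k + 1)), ∑ t, L' i t * w t = 0) ∧
        (pts (fun i => algebraMap (MvPolynomial (Fin 4) K) (OriginLocalization K 4) (∑ t, C (L' i t) * X t))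
          (Ideal.span {algebraMap (MvPolynomial (Fin 4) K) (OriginLocalization K 4) G₁}) d).Nonempty ∧
        Nat.factorial d < deltaS (fun i => algebraMap (MvPolynomial (Fin 4) K) (OriginLocalization K 4) (∑ t, C (L' i t) * X t))
          (Ideal.span {algebraMap (MvPolynomial (Fin 4) K) (OriginLocalization K 4) G₁}) d ∧
        d * alphaS (fun i => algebraMap (MvPolynomial (Fin 4) K) (OriginLocalization K 4) (∑ t, C (L' i t) * X t))
          (Ideal.span {algebraMap (MvPolynomial (Fin 4) K) (OriginLocalization K 4) G₁}) d ≤ (m - 1) * Nat.factorial d) ∧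
      0 < alphaS (fun i => algebraMap (MvPolynomial (Fin 4) K) (OriginLocalization K 4) (∑ t, C (L' i t) * X t))
          (Ideal.span {algebraMap (MvPolynomial (Fin 4) K) (OriginLocalization K 4) G₁}) d ∧
      betaS (fun i => algebraMap (MvPolynomial (Fin 4) K) (OriginLocalization K 4) (∑ t, C (L' i t) * X t))
          (Ideal.span {algebraMap (MvPolynomial (Fin 4) K) (OriginLocalization K 4) G₁}) d ≤
        betaS (fun i => algebraMap (MvPolynomial (Fin 4) K) (OriginLocalization K 4) (∑ t, C (L i t) * X t))
          (Ideal.span {algebraMap (MvPolynomial (Fin 4) K) (OriginLocalization K 4) G}) d := by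
  classical
  set alg := algebraMap (MvPolynomial (Fin 4) K) (OriginLocalization K 4) with halg
  have hp : p ≤ (c k).r.degree + d := hpo.le
  -- (1) the direction of the step lies in the vertex; the y-rows kill it
  have ho : ordZero (c k).F = (((c k).r.degree + d : ℕ) : ℕ∞) := by
    rw [hF, PhiLine.ordZero_monomial_one_mul, hd, Nat.cast_add]
  have hdirV : direction (j k) (b k) ∈ resVertex (c k) :=
    direction_mem_resVertex_of_shade_eq (j k) hbj ho hdiv hpo ho2 hshade
  have hdir : direction (j k) (b k) = Function.update (b k) (j k) 1 := rfl
  have hdirj : direction (j k) (b k) (j k) = 1 := by rw [hdir, Function.update_self]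
  have hdirh : direction (j k) (b k) h ≠ 0 := by
    rcases hhit with hjh | hbh
    · rw [← hjh, hdirj]; exact one_ne_zero
    · have hjh : j k ≠ h := fun hh => hbh (by rw [← hh]; exact hbj)
      rw [hdir, Function.update_of_ne (Ne.symm hjh)]; exact hbh
  have hyk : ∀ i, i ≠ u1 2 → i ≠ u2 2 → ∑ t, L i t * direction (j k) (b k) t = 0 := fun i h1 h2 => hy i h1 h2 _ hdirV
  -- the cone letters have no `u`-coordinates in the entry frame
  have hPM : ∀ z ∈ P, M z (u1 2) = 0 ∧ M z (u2 2) = 0 := fun z hz =>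
    inverse_apply_eq_zero_of_cone he hM hy (hPcone z hz)
  -- (2) the twist `ũ₂ = u₂ − λ u₁`
  set lam : K := (∑ t, L (u2 2) t * direction (j k) (b k) t) * (direction (j k) (b k) h)⁻¹ with hlam
  set S : Fin (2 + 2) → Fin 4 → K := Function.update L (u2 2) (L (u2 2) - lam • L (u1 2)) with hS
  have hSq : S (u2 2) = L (u2 2) - lam • L (u1 2) := by rw [hS, Function.update_self]
  have hSi : ∀ i, i ≠ u2 2 → S i = L i := fun i hi => by rw [hS, Function.update_of_ne hi]
  have hSu1 : S (u1 2) = Pi.single h 1 := by rw [hSi _ u1_ne_u2, hLu1]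
  have hMS := twist_left_inverse hM u1_ne_u2 lam hSq hSi
  set MS : Fin 4 → Fin (2 + 2) → K := fun t i => M t i + if i = u1 2 then lam * M t (u2 2) else 0 with hMSdef
  have hMS' : ∀ t u, ∑ i, MS t i * S i u = if t = u then 1 else 0 := hMS
  have hPMS : ∀ z ∈ P, MS z (u1 2) = 0 ∧ MS z (u2 2) = 0 := by
    intro z hz
    obtain ⟨h1, h2⟩ := hPM z hz
    refine ⟨?_, ?_⟩
    · show M z (u1 2) + (if u1 2 = u1 2 then lam * M z (u2 2) else 0) = 0
      rw [if_pos rfl, h1, h2, mul_zero, add_zero]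
    · show M z (u2 2) + (if u2 2 = u1 2 then lam * M z (u2 2) else 0) = 0
      rw [if_neg (Ne.symm u1_ne_u2), h2, add_zero]
  have hkill : ∀ i, i ≠ u1 2 → ∑ t, S i t * direction (j k) (b k) t = 0 := by
    intro i hi
    by_cases hi2 : i = u2 2
    · subst hi2
      rw [hSq]
      simp only [Pi.sub_apply, Pi.smul_apply, smul_eq_mul, sub_mul, Finset.sum_sub_distrib, mul_assoc, ← Finset.mul_sum]
      rw [hLu1, sum_single_mul, hlam, inv_mul_cancel_right₀ hdirh, sub_self]
    · rw [hSi i hi2]; exact hyk i hi hi2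
  have hyS : ∀ i, i ≠ u1 2 → i ≠ u2 2 → ∀ w ∈ resVertex (c k), ∑ t, S i t * w t = 0 := fun i h1 h2 w hw' => by
    rw [hSi i h2]; exact hy i h1 h2 w hw'
  -- the polygon data in the twisted frame
  have hgenL := span_range_frame_eq_maximalIdeal L M hM
  have hgenS := span_range_frame_eq_maximalIdeal S MS hMS'
  have hdim := PhiLine.ringKrullDim_originLocalization_two_add_two (K := K)
  have hJμ : Ideal.span {alg G} ≤ maximalIdeal (OriginLocalization K 4) ^ d :=
    PhiLine.span_singleton_algebraMap_le_maximalIdeal_pow hd.symm.le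
  have hframeS := frameRow_twist (K := K) lam hSq hSi
  obtain ⟨hneS, hδS, hβS⟩ := PhiLine.twist_binders (fun i => alg (∑ t, C (L i t) * X t)) hgenL hdim (-alg (C lam)) hJμ hne hδ
  rw [← halg] at hframeS
  rw [← hframeS] at hneS hδS hβS
  -- the `hT` hypothesis of the letter-set α-clause, for every arrival frame off `S`
  have harrT : ∀ (L' : Fin (2 + 2) → Fin 4 → K), L' (u1 2) = Pi.single (j k) 1 →
      (∀ i, i ≠ u1 2 → L' i = Function.update (S i) (j k) 0) →
      ∀ i ∈ insert (j k) P, alg (X i) ∈ yu1Ideal (fun i => alg (∑ t, C (L' i t) * X t)) := by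
    intro L' hL'u1 hL' i hi
    rcases Finset.mem_insert.mp hi with rfl | hiP
    · refine PhiLine.algebraMap_X_mem_yu1Ideal_of_eq ?_
      show alg (∑ t, C (L' (u1 2) t) * X t) = alg (X (j k))
      rw [hL'u1, halg, frameRow_single]
    · obtain ⟨hz1, hz2⟩ := hPMS i hiP
      exact arrival_X_mem_yu1Ideal hMS' hL'u1 hL' hz1 hz2
  -- (3) the common tail: from an arrival frame with the law's outputs to the run invariant
  have hBS := matrix_mul_eq_one_of_sum (L := S) (M := MS) hMS'
  have hSB := mul_eq_one_comm.mp hBS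
  obtain ⟨Ψ, hΨ, hΨA, Q, hQmem, hGΨ⟩ :=
    PhiLine.exists_label_of_yRows_annihilate p hdp hF hd hSB hBS he hyS
  have hnear2 : ∀ i : Fin 2, ∑ t, S (Fin.castAdd 2 i) t * Function.update (b k) (j k) 1 t = 0 := fun i => by
    rw [← hdir]; exact hkill _ (castAdd_ne_u1 i)
  obtain ⟨Q', hH₀⟩ := PhiLine.chartTransform_translate_label hbj (fun i : Fin 2 => S (Fin.castAdd 2 i)) hnear2 hΨ hQmem hGΨ
    hd.symm.le
  obtain ⟨R, hres, hRmem⟩ := PhiLine.step_F_eq_monomial_mul_residual (p := p) hF hd.symm.le hp (j k) hbj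
  rw [hF', monomial_one_mul_cancel_left_iff] at hres
  have hr'j : (((c k).r.filter fun i => b k i = 0).update (j k) ((c k).r.degree + d - p)) (j k) = (c k).r.degree + d - p := by
    rw [Finsupp.coe_update, Function.update_self]
  have hpn : p - ((c k).r.degree + d - p) = e := by omega
  have hR : R ∈ Ideal.span {(X (j k) : MvPolynomial (Fin 4) K) ^ e} := by
    have := hRmem (j k) (by rw [hr'j]; exact hndvd)
    rwa [hr'j, hpn] at this
  have hε := PhiLine.constantCoeff_prod_ne_zero (b k) (fun i => (c k).r i)
  have hT := PhiLine.two_le_finrank_additiveSubspace_of_resVertex hF₁ hd₁ he₁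
  have hcritn : (c k).r.degree + d - p + e ≤ p := hep.le
  have tail : ∀ (L' : Fin (2 + 2) → Fin 4 → K) (M' : Fin 4 → Fin (2 + 2) → K),
      (∀ t u, ∑ i, M' t i * L' i u = if t = u then 1 else 0) → L' (u1 2) = Pi.single (j k) 1 →
      (∀ i, i ≠ u1 2 → L' i = Function.update (S i) (j k) 0) →
      alphaS (fun i => alg (∑ t, C (L' i t) * X t)) (Ideal.span {alg G₁}) d + Nat.factorial d =
        deltaS (fun i => alg (∑ t, C (S i t) * X t)) (Ideal.span {alg G}) d →
      betaS (fun i => alg (∑ t, C (L' i t) * X t)) (Ideal.span {alg G₁}) d ≤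
        betaS (fun i => alg (∑ t, C (S i t) * X t)) (Ideal.span {alg G}) d →
      ∃ (L'' : Fin (2 + 2) → Fin 4 → K) (M'' : Fin 4 → Fin (2 + 2) → K),
        ((∀ t u, ∑ i, M'' t i * L'' i u = if t = u then 1 else 0) ∧ L'' (u1 2) = Pi.single (j k) 1 ∧
          (∀ i, i ≠ u1 2 → i ≠ u2 2 → ∀ w ∈ resVertex (c (k + 1)), ∑ t, L'' i t * w t = 0) ∧
          (pts (fun i => alg (∑ t, C (L'' i t) * X t)) (Ideal.span {alg G₁}) d).Nonempty ∧
          Nat.factorial d < deltaS (fun i => alg (∑ t, C (L'' i t) * X t)) (Ideal.span {alg G₁}) d ∧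
          d * alphaS (fun i => alg (∑ t, C (L'' i t) * X t)) (Ideal.span {alg G₁}) d ≤ (m - 1) * Nat.factorial d) ∧
        0 < alphaS (fun i => alg (∑ t, C (L'' i t) * X t)) (Ideal.span {alg G₁}) d ∧
        betaS (fun i => alg (∑ t, C (L'' i t) * X t)) (Ideal.span {alg G₁}) d ≤
          betaS (fun i => alg (∑ t, C (L i t) * X t)) (Ideal.span {alg G}) d := by
    intro L' M' hM' hL'u1 hL' hαeq hβle
    -- the child's polygon in the arrival frame: non-empty, `d·αs′ ≤ (m−1)·d!` by isolation on `insert (j k) P`, hence `0 < αs′ < d!`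
    have hgen' := span_range_frame_eq_maximalIdeal L' M' hM'
    obtain ⟨hne', hα2⟩ := PhiLine.mul_alphaS_le_of_isIsolated_letters (p := p) (d := d) (n := m) hF₁ hiso₁
      (insert (j k) P) hcritT hmd (fun i => alg (∑ t, C (L' i t) * X t)) hgen' (harrT L' hL'u1 hL')
    have hα2' : d * alphaS (fun i => alg (∑ t, C (L' i t) * X t)) (Ideal.span {alg G₁}) d ≤ (m - 1) * Nat.factorial d := hα2
    have hα' : alphaS (fun i => alg (∑ t, C (L' i t) * X t)) (Ideal.span {alg G₁}) d < Nat.factorial d :=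
      lt_factorial_of_mul_le hα2' hmd hm1
    have hα0 : 0 < alphaS (fun i => alg (∑ t, C (L' i t) * X t)) (Ideal.span {alg G₁}) d := by
      have := hδS; omega
    -- the re-adaptation (XVI, exponent `e`, no order hypothesis on the uncleaned weak transform) and the new y-rows (XIII)
    have hB'A := matrix_mul_eq_one_of_sum (L := L') (M := M') hM'
    have hAB' := mul_eq_one_comm.mp hB'A
    have hfun : (fun i : Fin 2 => ∑ t, C (Function.update (S (Fin.castAdd 2 i)) (j k) 0 t) * X t) =
        (fun i : Fin 2 => ∑ t, C (L' (Fin.castAdd 2 i) t) * X t) := by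
      funext i
      rw [hL' _ (castAdd_ne_u1 i)]
    have hH₀' : PointBlowup.translate (b k) (CentreBlowup.chartTransform d Finset.univ (j k) G) =
        aeval (fun i : Fin 2 => ∑ t, C (L' (Fin.castAdd 2 i) t) * X t) Ψ + X (j k) * Q' := by
      rw [hH₀, hfun]
    have hu12 : u1 2 ∈ ({u1 2, u2 2} : Finset (Fin (2 + 2))) := Finset.mem_insert_self _ _
    obtain ⟨lam', A', B', hA'B', hB'A', hrows, hA'u1, hA'u2, hne'', hδ'', hαeq'', hβeq''⟩ :=
      PhiLine.exists_label_readaptation_of_step_pow p (d := d) hdp hAB' hB'A hu12 hL'u1 hL'u1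
        (e := e) he1 hres hd₁.symm.le hε hR hH₀' hΨ hΨA hT hne' hα0 hα'
    have hy'' := PhiLine.yRows_annihilate_of_label p hdp hF₁ hd₁ hA'B' hB'A' he₁ hδ''
    refine ⟨A', B', ⟨sum_of_matrix_mul_eq_one hB'A', by rw [hA'u1, hL'u1], hy'', hne'', hδ'', by rw [hαeq'']; exact hα2'⟩,
      by rw [hαeq'']; exact hα0, ?_⟩
    rw [hβeq'']
    exact hβle.trans hβS
  -- the LOSE law's threshold `d·(αs′ + 1) ≤ e·d!` from the set clause `d·αs′ ≤ (m − 1)·d!` and `m ≤ e`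
  have hthr : ∀ a : ℕ, d * a ≤ (m - 1) * Nat.factorial d → d * (a + 1) ≤ e * Nat.factorial d := fun a ha =>
    mul_succ_le_mul_factorial (ha.trans (Nat.mul_le_mul_right _ (by omega))) he1
  -- (4) the two charts
  rcases hhit with hjh | hbh
  · -- chart `h`: the LOSE law from the child side at the newborn (XV §4, exponent `e`)
    set L' : Fin (2 + 2) → Fin 4 → K := fun i => if i = u1 2 then Pi.single h 1 else Function.update (S i) h 0 with hL'def
    have hL'u1 : L' (u1 2) = Pi.single h 1 := by rw [hL'def]; exact if_pos rfl
    have hL' : ∀ i, i ≠ u1 2 → L' i = Function.update (S i) h 0 := fun i hi => by rw [hL'def]; exact if_neg hi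
    have hM' := arrival_left_inverse hMS' hSu1 hL'u1 hL'
    have hbh : b k h = 0 := by rw [← hjh]; exact hbj
    have hnear : ∀ i, i ≠ u1 2 → ∑ t, S i t * Function.update (b k) h 1 t = 0 := fun i hi => by
      rw [← hjh, ← hdir]; exact hkill i hi
    have hgen' := span_range_frame_eq_maximalIdeal L' _ hM'
    obtain ⟨hne', hα2⟩ := PhiLine.mul_alphaS_le_of_isIsolated_letters (p := p) (d := d) (n := m) hF₁ hiso₁
      (insert (j k) P) hcritT hmd (fun i => alg (∑ t, C (L' i t) * X t)) hgen'
      (harrT L' (by rw [hL'u1, hjh]) (fun i hi => by rw [hL' i hi, hjh]))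
    have hα2' : d * alphaS (fun i => alg (∑ t, C (L' i t) * X t)) (Ideal.span {alg G₁}) d ≤ (m - 1) * Nat.factorial d := hα2
    have hα' : d * (alphaS (fun i => alg (∑ t, C (L' i t) * X t)) (Ideal.span {alg G₁}) d + 1) ≤ e * Nat.factorial d :=
      hthr _ hα2'
    have hF'' : (CentreBlowup.step p Finset.univ h (b k) (c k)).F =
        monomial (((c k).r.filter fun i => b k i = 0).update h ((c k).r.degree + d - p)) 1 * G₁ := by
      rw [← hjh]; exact hF'
    obtain ⟨hαeq, hβle⟩ := PhiLine.betaS_step_le_of_lose_of_child_pow (n := e) hF hd hp hbh hndvd hcritn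
      S L' MS _ hMS' hM' hSu1 hnear hL'u1 hL' hneS hδS hF'' hd₁.symm.le hne' hα'
    exact tail L' _ hM' (by rw [hL'u1, hjh]) (fun i hi => by rw [hL' i hi, hjh]) hαeq hβle
  · -- chart `j k ≠ h`, `b k h ≠ 0`: the translated law (R3b-n, exponent `e`)
    have hjh : j k ≠ h := fun hh => hbh (by rw [← hh]; exact hbj)
    -- replace the pivot row by `e_{j k}`, then drop the `j k`-coefficients
    set S₂ : Fin (2 + 2) → Fin 4 → K := Function.update S (u1 2) (Pi.single (j k) 1) with hS₂
    have hS₂u1 : S₂ (u1 2) = Pi.single (j k) 1 := by rw [hS₂, Function.update_self]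
    have hS₂i : ∀ i, i ≠ u1 2 → S₂ i = S i := fun i hi => by rw [hS₂, Function.update_of_ne hi]
    have ha : ∑ t, (Pi.single (j k) (1 : K) : Fin 4 → K) t * MS t (u1 2) ≠ 0 :=
      coeff_replaceRow_ne_zero hMS' (piv := u1 2) (w := direction (j k) (b k)) hkill (by rw [sum_single_mul, hdirj]; exact one_ne_zero)
    have hM₂ := replaceRow_left_inverse hMS' (u1 2) (Pi.single (j k) 1) ha hS₂u1 hS₂i
    set L' : Fin (2 + 2) → Fin 4 → K := fun i => if i = u1 2 then Pi.single (j k) 1 else Function.update (S i) (j k) 0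
      with hL'def
    have hL'u1 : L' (u1 2) = Pi.single (j k) 1 := by rw [hL'def]; exact if_pos rfl
    have hL' : ∀ i, i ≠ u1 2 → L' i = Function.update (S i) (j k) 0 := fun i hi => by rw [hL'def]; exact if_neg hi
    have hL'₂ : ∀ i, i ≠ u1 2 → L' i = Function.update (S₂ i) (j k) 0 := fun i hi => by rw [hL' i hi, hS₂i i hi]
    have hM' := arrival_left_inverse hM₂ hS₂u1 hL'u1 hL'₂
    have hnear : ∀ i, i ≠ u1 2 → ∑ t, S i t * Function.update (b k) (j k) 1 t = 0 := fun i hi => by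
      rw [← hdir]; exact hkill i hi
    have hgen' := span_range_frame_eq_maximalIdeal L' _ hM'
    obtain ⟨hne', hα2⟩ := PhiLine.mul_alphaS_le_of_isIsolated_letters (p := p) (d := d) (n := m) hF₁ hiso₁
      (insert (j k) P) hcritT hmd (fun i => alg (∑ t, C (L' i t) * X t)) hgen' (harrT L' hL'u1 hL')
    have hα2' : d * alphaS (fun i => alg (∑ t, C (L' i t) * X t)) (Ideal.span {alg G₁}) d ≤ (m - 1) * Nat.factorial d := hα2
    have hα' : d * (alphaS (fun i => alg (∑ t, C (L' i t) * X t)) (Ideal.span {alg G₁}) d + 1) ≤ e * Nat.factorial d :=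
      hthr _ hα2'
    obtain ⟨hαeq, hβle⟩ := PhiLine.betaS_step_le_of_lose_translated_of_child_pow (n := e) hF hd hp hjh hbj hbh hndvd hcritn
      S L' MS _ hMS' hM' hSu1 hnear hL'u1 hL' hneS hδS hF' hd₁.symm.le hne' hα'
    exact tail L' _ hM' hL'u1 hL' hαeq hβle

end Lose

end ResCone

end Summit.ResolutionOfSingularities.ResolutionOfSingularities.Theorems.PIDim4

end
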